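import Mathlib

/-!
# BSD rank-≤1 residual cell, class X11b @ 3 — the KUMMER step of the analytic-road certificate ((D): `Cl_S[p] = 0 ⇒ A(S,p) = U_S/U_S^p`)

HONEST FRAMING (cell `b2b-bsdres-*`): this file books NOTHING; it is the elementary algebra behind the last line of an analytic-road
record (x11b GEN 13/14, `HOME/b2b-bsdres-x11b/g13/ANALYTIC-ROAD.md` §1 (D)), left "on paper" in `X11b/UnitSaturationCertificate`:
additively, `M = Additive A^×`, `I` = the group of fractional ideals, `D : M →+ I` the divisor map, `IS ≤ I` the subgroup generated
by the primes above `S`; then `U_S = {u | D u ∈ IS}` (the `S`-units), `Cl_S(A) = I ⧸ (range D ⊔ IS)`, and the descent space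
`A(S,p) = {x ∈ A^×/A^{×p} | (x) ∈ I^p · IS}`. Statements:
* `exists_sub_nsmul_divisor_mem` — if `Cl_S(A)` has no `p`-torsion (`hCl`, the conclusion of `X11b/SClassCertificate` read in
  `I ⧸ (range D ⊔ IS)`) and `D x = p•a + s` with `s ∈ IS`, then `x = u + p•y` with `u` an `S`-unit: **`A(S,p)` is the image of `U_S`**;
* `exists_eq_sum_add_nsmul_of_clS` — composed with (C3a) (`X11b/UnitSaturationCertificate.exists_eq_sum_add_nsmul_of_charMatrix`, taken
  here as the hypothesis `hgen` on `U_S`): every element of `A(S,p)` is `∑ f_j•u_j + p•y` for the certified units and `S`-units `u_j` —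
  the descent's ambient space is COMPLETE, so a Selmer dimension computed inside `⟨u_j⟩` is the Selmer dimension.
Pure algebra of abelian groups; no number theory is formalised here. X11 ∧ r = 1 ∧ p = 3 stays CONSTRUCTION-SHAPED (R6.2);
not "finishing BSD".
-/

namespace Summit.BirchSwinnertonDyer.Rank1Residual.X11b.KummerDescentSpace

open Finset

variable {M I : Type*} [AddCommGroup M] [AddCommGroup I] {p n : ℕ}

/-- **Kummer step.** `D : M →+ I` (divisors), `IS ≤ I` (ideals supported on `S`). If `Cl_S = I ⧸ (range D ⊔ IS)` has no `p`-torsion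
(`hCl`: `p•a ∈ range D ⊔ IS ⇒ a ∈ range D ⊔ IS`) and `D x = p•a + s` with `s ∈ IS` (i.e. the class of `x` lies in `A(S,p)`), then
`x = u + p•y` with `D u ∈ IS` (`u` an `S`-unit). Proof: `p•a = D x − s ∈ range D ⊔ IS`, so `a = D y + s'`, and `u := x − p•y` has
`D u = s + p•s' ∈ IS`. -/
theorem exists_sub_nsmul_divisor_mem (D : M →+ I) (IS : AddSubgroup I)
    (hCl : ∀ a : I, p • a ∈ D.range ⊔ IS → a ∈ D.range ⊔ IS)
    {x : M} {a : I} {s : I} (hs : s ∈ IS) (hx : D x = p • a + s) :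
    ∃ y : M, D (x - p • y) ∈ IS := by
  have hpa : p • a ∈ D.range ⊔ IS := by
    have : p • a = D x + (-s) := by rw [hx]; abel
    rw [this]
    exact AddSubgroup.add_mem_sup ⟨x, rfl⟩ (IS.neg_mem hs)
  obtain ⟨d, hd, s', hs', hds⟩ := AddSubgroup.mem_sup.mp (hCl a hpa)
  obtain ⟨y, rfl⟩ := hd
  refine ⟨y, ?_⟩
  have : D (x - p • y) = s + p • s' := by
    rw [map_sub, map_nsmul, hx, ← hds, smul_add]
    abel
  rw [this]
  exact IS.add_mem hs (IS.nsmul_mem hs' p)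

/-- Bridge from the shape of `X11b/SClassCertificate` (no `p`-torsion in the quotient `Cl(A) ⧸ ⟨S-classes⟩`, here additively:
`G = I ⧸ range D`, `H` = the image of `IS`) to the form `hCl` used below (`p•a ∈ range D ⊔ IS ⇒ a ∈ range D ⊔ IS`). -/
theorem noPTorsion_sup_of_quotient (D : M →+ I) (IS : AddSubgroup I)
    (h : ∀ z : (I ⧸ D.range) ⧸ IS.map (QuotientAddGroup.mk' D.range), p • z = 0 → z = 0)
    (a : I) (ha : p • a ∈ D.range ⊔ IS) : a ∈ D.range ⊔ IS := by
  set H : AddSubgroup (I ⧸ D.range) := IS.map (QuotientAddGroup.mk' D.range) with hH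
  -- the class of `p•a` in `G = I ⧸ range D` lies in `H`
  have hpa : ((p • a : I) : I ⧸ D.range) ∈ H := by
    obtain ⟨d, hd, s, hs, hds⟩ := AddSubgroup.mem_sup.mp ha
    rw [← hds, QuotientAddGroup.mk_add, (QuotientAddGroup.eq_zero_iff d).mpr hd, zero_add]
    exact AddSubgroup.mem_map_of_mem (QuotientAddGroup.mk' D.range) hs
  -- so the double class of `a` is `p`-torsion, hence zero
  have hz : (((a : I ⧸ D.range)) : (I ⧸ D.range) ⧸ H) = 0 := by
    apply h
    rw [← QuotientAddGroup.mk_nsmul, ← QuotientAddGroup.mk_nsmul, QuotientAddGroup.eq_zero_iff]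
    exact hpa
  rw [QuotientAddGroup.eq_zero_iff] at hz
  obtain ⟨s, hs, hsa⟩ := AddSubgroup.mem_map.mp hz
  -- `mk s = mk a`, i.e. `-s + a ∈ range D`
  have hmem : -s + a ∈ D.range := by
    rw [← QuotientAddGroup.eq]
    exact hsa
  have ha' : a = (-s + a) + s := by abel
  rw [ha']
  exact AddSubgroup.add_mem_sup hmem hs

/-- **(D) completeness of the descent space.** With `hCl` as above and (C3a) in the form the record certifies it — every `S`-unit is
`∑ f_j•u_j + p•y` (`hgen`, = `UnitSaturationCertificate.exists_eq_sum_add_nsmul_of_charMatrix` on `U_S`) — every `x` whose divisor is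
`p•a + s`, `s ∈ IS`, is itself `∑ f_j•u_j + p•y`: the certified units and `S`-units generate `A(S,p)`. -/
theorem exists_eq_sum_add_nsmul_of_clS (D : M →+ I) (IS : AddSubgroup I)
    (hCl : ∀ a : I, p • a ∈ D.range ⊔ IS → a ∈ D.range ⊔ IS)
    (u : Fin n → M) (hgen : ∀ w : M, D w ∈ IS → ∃ f : Fin n → ℕ, ∃ y : M, w = ∑ j, f j • u j + p • y)
    {x : M} {a : I} {s : I} (hs : s ∈ IS) (hx : D x = p • a + s) :
    ∃ f : Fin n → ℕ, ∃ y : M, x = ∑ j, f j • u j + p • y := by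
  obtain ⟨y, hy⟩ := exists_sub_nsmul_divisor_mem D IS hCl hs hx
  obtain ⟨f, y', hfy⟩ := hgen (x - p • y) hy
  refine ⟨f, y' + y, ?_⟩
  have : x = (x - p • y) + p • y := by abel
  rw [this, hfy, smul_add]
  abel

end Summit.BirchSwinnertonDyer.Rank1Residual.X11b.KummerDescentSpace
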